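import Summits.ValiantsHypothesis.ValiantsHypothesis.Theorems.KPlusLogSqLawTropicalBTopHeavyCoreAssembly

/-!
# Route «KPlusLogSqLaw», crux `TropicalB` (stmt-ValiantsHypothesis-19771) — THE TOP-HEAVY CORE, part 2 (the one-jump arc exists) and
# CORE LAW C assembled: no design has dominant terms `c₁^{m−2}c₂²`, `c₁^{m−1}c₃`, `c₀^{m−1}c₄` with the `c₄`-term latest

HONEST FRAMING.  Final kernel part of this seat's all-`m` «CORE LAW C» (val-sym-trop-p1 g21, cell `pub-symmetroid`, 2026-08-28; memo
HOME/val-sym-trop-p1/g21/CORE-LAW-C-g21.md; `--supports stmt-ValiantsHypothesis-19771 --as helper`).  §1–2 are pure combinatorics of permutations of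
`Fin m` (a single `m`-cycle `P`, an arbitrary permutation `τ`, the chain of `P`-arcs `(τ⁻¹ j, j]` over the support of `τ`, their covering number, a
pigeonhole); §3 assembles parts 1 (…TopHeavyCoreStructure) and 3 (…TopHeavyCoreAssembly).  A census-structure law: for every `m ≥ 2` and every five
classes with exponents `d c₀ < d c₁ < d c₂ < d c₃` and `d c₀ = min d`, the three class multisets above are never simultaneously dominant when the
`c₄`-term is the latest — so `(m, K)` is not counting-tight on the region `d c₄ + (m−1) d c₀ > max((m−2) d c₁ + 2 d c₂, (m−1) d c₁ + d c₃)` (corollary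
for the census in a sequel).  Nothing here bears on `TropicalB` in its window, `WeakLifting`, the doors, `MatrixDescartes` (stmt-ValiantsHypothesis-18050)
or VP ≠ VNP.
[combinatorics: folklore; the law and its packaging are this cell's — located first by val-sym-trop-p5 g13's `ktight` as the minimal infeasible core
`{122, 113, 4}` of `(3,5)`, verified exhaustively at the combinatorial core for `m ≤ 6` before this proof]
-/

set_option linter.dupNamespace false
set_option autoImplicit false

namespace Summit.ValiantsHypothesis.ValiantsHypothesis.Theorems.KPlusLogSqLaw.TopHeavyCore

open Summit.ValiantsHypothesis.ValiantsHypothesis.Theorems.MatrixDescartes.Negative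
open scoped BigOperators
open Finset

variable {m : ℕ}

/-! ## 1. A single `m`-cycle: powers -/

section Cycle

variable (P : Equiv.Perm (Fin m)) (hfix : ∀ x, P x ≠ x) (hcyc : ∀ x y, P.SameCycle x y)
include hfix hcyc

/-- a fixed-point-free permutation with a single cycle class is a cycle (on nonempty `Fin m`). -/
theorem isCycle_P (hm : 0 < m) : P.IsCycle :=
  ⟨⟨0, hm⟩, hfix _, fun y _ => hcyc _ y⟩

/-- … and its order is `m` (its support is everything). -/
theorem orderOf_P (hm : 0 < m) : orderOf P = m := by
  classical
  rw [(isCycle_P P hfix hcyc hm).orderOf]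
  have : P.support = univ := Finset.eq_univ_of_forall fun x => Equiv.Perm.mem_support.mpr (hfix x)
  rw [this, card_univ, Fintype.card_fin]

/-- every point is reached from every point by a power `< m`. -/
theorem exists_pow_lt (x y : Fin m) : ∃ i, i < m ∧ (P ^ i) x = y := by
  have hm : 0 < m := Fin.pos x
  obtain ⟨i, hi, h⟩ := (hcyc x y).exists_pow_eq'
  exact ⟨i, by rwa [orderOf_P P hfix hcyc hm] at hi, h⟩

/-- no proper power fixes a point. -/
theorem pow_apply_ne_self (x : Fin m) {r : ℕ} (hr0 : 0 < r) (hrm : r < m) : (P ^ r) x ≠ x := by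
  intro h
  have hm : 0 < m := Fin.pos x
  have h1 : P ^ r = 1 := ((isCycle_P P hfix hcyc hm).pow_eq_one_iff' (hfix x)).mpr h
  have hdvd : orderOf P ∣ r := orderOf_dvd_of_pow_eq_one h1
  rw [orderOf_P P hfix hcyc hm] at hdvd
  exact absurd (Nat.le_of_dvd hr0 hdvd) (not_le.mpr hrm)

/-- powers below `m` act injectively on a point. -/
theorem pow_apply_injOn (x : Fin m) {a c : ℕ} (ha : a < m) (hc : c < m) (h : (P ^ a) x = (P ^ c) x) : a = c := by
  by_contra hne
  wlog hlt : a < c generalizing a c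
  · exact this hc ha h.symm (Ne.symm hne) (lt_of_le_of_ne (not_lt.mp hlt) (Ne.symm hne))
  have key : (P ^ (c - a)) ((P ^ a) x) = (P ^ a) x := by
    rw [← Equiv.Perm.mul_apply, ← pow_add, Nat.sub_add_cancel hlt.le, ← h]
  exact pow_apply_ne_self P hfix hcyc ((P ^ a) x) (Nat.sub_pos_of_lt hlt) (by omega) key

end Cycle

/-! ## 2. The chain of arcs over the support of `τ` and its covering number (no definitions: arcs are explicit images) -/

section Arc

variable (P τ : Equiv.Perm (Fin m)) (hfix : ∀ x, P x ≠ x) (hcyc : ∀ x y, P.SameCycle x y)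
include hfix hcyc

/-- for `j` moved by `τ`: a MINIMAL positive power of `P` taking `τ⁻¹ j` to `j`; it is `< m`. -/
theorem exists_len (j : Fin m) (hj : τ j ≠ j) :
    ∃ n, 0 < n ∧ n < m ∧ (P ^ n) (τ⁻¹ j) = j ∧ ∀ k, 0 < k → k < n → (P ^ k) (τ⁻¹ j) ≠ j := by
  classical
  obtain ⟨i, him, h⟩ := exists_pow_lt P hfix hcyc (τ⁻¹ j) j
  have hi0 : 0 < i := by
    rcases Nat.eq_zero_or_pos i with rfl | hi
    · exfalso; apply hj
      simp only [pow_zero, Equiv.Perm.one_apply] at h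
      have := congrArg τ h; simpa using this.symm
    · exact hi
  have hex : ∃ n, 0 < n ∧ (P ^ n) (τ⁻¹ j) = j := ⟨i, hi0, h⟩
  refine ⟨Nat.find hex, (Nat.find_spec hex).1, ?_, (Nat.find_spec hex).2, fun k hk0 hk hPk => ?_⟩
  · exact lt_of_le_of_lt (Nat.find_min' hex ⟨hi0, h⟩) him
  · exact Nat.find_min hex hk ⟨hk0, hPk⟩

/-- ARC LEMMAS.  Fix `j` moved by `τ`, its minimal length `n` and the arc `U = {P¹(τ⁻¹ j), …, Pⁿ(τ⁻¹ j) = j}`: `j` and `P(τ⁻¹ j)` are on the arc,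
the arc is short, the start `τ⁻¹ j` and `P j` are off it, the arc is closed under `P` except at its end `j`, and it is entered only from `τ⁻¹ j`. -/
theorem arc_props {j : Fin m} {n : ℕ} (hn0 : 0 < n) (hnm : n < m) (hPn : (P ^ n) (τ⁻¹ j) = j) (U : Finset (Fin m))
    (hU : U = (range n).image fun k => (P ^ (k + 1)) (τ⁻¹ j)) :
    j ∈ U ∧ P (τ⁻¹ j) ∈ U ∧ U.card < m ∧ τ⁻¹ j ∉ U ∧ (∀ x, x ∈ U → x ≠ j → P x ∈ U) ∧ P j ∉ U ∧
      (∀ x, x ∉ U → P x ∈ U → x = τ⁻¹ j) := by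
  classical
  have mem : ∀ x, x ∈ U ↔ ∃ k, k < n ∧ (P ^ (k + 1)) (τ⁻¹ j) = x := by
    intro x; rw [hU]; simp only [mem_image, mem_range]
  refine ⟨?_, ?_, ?_, ?_, ?_, ?_, ?_⟩
  · exact (mem j).mpr ⟨n - 1, by omega, by rw [Nat.sub_add_cancel hn0]; exact hPn⟩
  · exact (mem _).mpr ⟨0, hn0, by rw [zero_add, pow_one]⟩
  · rw [hU]; exact (card_image_le.trans (by rw [card_range])).trans_lt hnm
  · intro h
    obtain ⟨k, hk, hkx⟩ := (mem _).mp h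
    exact pow_apply_ne_self P hfix hcyc (τ⁻¹ j) (Nat.succ_pos k) (by omega) hkx
  · intro x hx hxj
    obtain ⟨k, hk, hkx⟩ := (mem x).mp hx
    have hk1 : k + 1 < n := by
      by_contra hc
      have : k + 1 = n := by omega
      apply hxj; rw [← hkx, this]; exact hPn
    exact (mem _).mpr ⟨k + 1, hk1, by rw [pow_succ', Equiv.Perm.mul_apply, hkx]⟩
  · intro h
    obtain ⟨k, hk, hkx⟩ := (mem _).mp h
    have e : (P ^ (k + 1)) (τ⁻¹ j) = (P ^ (n + 1)) (τ⁻¹ j) := by rw [hkx, pow_succ', Equiv.Perm.mul_apply, hPn]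
    have hm' : n + 1 < m ∨ n + 1 = m := by omega
    rcases hm' with hm' | hm'
    · have := pow_apply_injOn P hfix hcyc (τ⁻¹ j) (by omega) hm' e
      omega
    · have hPm : (P ^ m) (τ⁻¹ j) = τ⁻¹ j := by
        have h1 : P ^ m = 1 := by
          have := pow_orderOf_eq_one P
          rwa [orderOf_P P hfix hcyc (Fin.pos j)] at this
        rw [h1, Equiv.Perm.one_apply]
      rw [hm', hPm] at e
      exact pow_apply_ne_self P hfix hcyc (τ⁻¹ j) (Nat.succ_pos k) (by omega) e
  · intro x hx hPx
    obtain ⟨k, hk, hkx⟩ := (mem _).mp hPx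
    rcases Nat.eq_zero_or_pos k with rfl | hk0
    · rw [zero_add, pow_one] at hkx; exact (P.injective hkx).symm
    · exfalso; apply hx
      refine (mem x).mpr ⟨k - 1, by omega, ?_⟩
      apply P.injective
      rw [← Equiv.Perm.mul_apply, ← pow_succ', show k - 1 + 1 + 1 = k + 1 by omega, hkx]

/-- an ARC FAMILY exists: arcs for all `j` moved by `τ` (anything for fixed `j`). -/
theorem exists_arcFamily : ∃ U : Fin m → Finset (Fin m), ∀ j, τ j ≠ j →
    (j ∈ U j ∧ P (τ⁻¹ j) ∈ U j ∧ (U j).card < m ∧ τ⁻¹ j ∉ U j ∧ (∀ x, x ∈ U j → x ≠ j → P x ∈ U j) ∧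
      P j ∉ U j ∧ (∀ x, x ∉ U j → P x ∈ U j → x = τ⁻¹ j)) := by
  classical
  have key : ∀ j, ∃ Uj : Finset (Fin m), τ j ≠ j →
      (j ∈ Uj ∧ P (τ⁻¹ j) ∈ Uj ∧ Uj.card < m ∧ τ⁻¹ j ∉ Uj ∧ (∀ x, x ∈ Uj → x ≠ j → P x ∈ Uj) ∧
        P j ∉ Uj ∧ (∀ x, x ∉ Uj → P x ∈ Uj → x = τ⁻¹ j)) := by
    intro j
    by_cases hj : τ j ≠ j
    · obtain ⟨n, hn0, hnm, hPn, -⟩ := exists_len P τ hfix hcyc j hj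
      exact ⟨_, fun _ => arc_props P τ hfix hcyc hn0 hnm hPn _ rfl⟩
    · exact ⟨∅, fun h => absurd h hj⟩
  choose U hU using key
  exact ⟨U, hU⟩

omit hfix hcyc in
/-- **the covering number is invariant along `P`**: for an arc family, `x` and `P x` lie in equally many arcs. -/
theorem cover_apply (U : Fin m → Finset (Fin m)) (hUF : ∀ j, τ j ≠ j → (j ∈ U j ∧ P (τ⁻¹ j) ∈ U j ∧ (U j).card < m ∧ τ⁻¹ j ∉ U j ∧ (∀ x, x ∈ U j → x ≠ j → P x ∈ U j) ∧
      P j ∉ U j ∧ (∀ x, x ∉ U j → P x ∈ U j → x = τ⁻¹ j))) (x : Fin m) :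
    ((univ.filter fun j => τ j ≠ j).filter fun j => P x ∈ U j).card =
      ((univ.filter fun j => τ j ≠ j).filter fun j => x ∈ U j).card := by
  classical
  set S := (univ.filter fun j => τ j ≠ j) with hS
  set A := S.filter fun j => x ∈ U j with hA
  set B := S.filter fun j => P x ∈ U j with hB
  have hAB : A \ B = S.filter fun j => j = x := by
    ext j
    simp only [hA, hB, hS, mem_sdiff, mem_filter, mem_univ, true_and]
    constructor
    · rintro ⟨⟨hj, hx⟩, hnot⟩
      refine ⟨hj, ?_⟩
      by_contra hxj
      exact hnot ⟨hj, (hUF j hj).2.2.2.2.1 x hx (Ne.symm hxj)⟩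
    · rintro ⟨hj, rfl⟩
      exact ⟨⟨hj, (hUF j hj).1⟩, fun h => (hUF j hj).2.2.2.2.2.1 h.2⟩
  have hBA : B \ A = S.filter fun j => j = τ x := by
    ext j
    simp only [hA, hB, hS, mem_sdiff, mem_filter, mem_univ, true_and]
    constructor
    · rintro ⟨⟨hj, hPx⟩, hnot⟩
      have := (hUF j hj).2.2.2.2.2.2 x (fun h => hnot ⟨hj, h⟩) hPx
      refine ⟨hj, ?_⟩
      rw [this]; simp
    · rintro ⟨hj, rfl⟩
      have hs : τ⁻¹ (τ x) = x := by simp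
      refine ⟨⟨hj, ?_⟩, fun h => ?_⟩
      · have := (hUF (τ x) hj).2.1; rwa [hs] at this
      · have := (hUF (τ x) hj).2.2.2.1; rw [hs] at this; exact this h.2
  have hcardAB : (A \ B).card = (B \ A).card := by
    rw [hAB, hBA]
    by_cases hx : τ x ≠ x
    · have h1 : (S.filter fun j => j = x) = {x} := by
        ext j; simp only [hS, mem_filter, mem_univ, true_and, mem_singleton]
        constructor
        · rintro ⟨-, rfl⟩; rfl
        · rintro rfl; exact ⟨hx, rfl⟩
      have h2 : (S.filter fun j => j = τ x) = {τ x} := by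
        ext j; simp only [hS, mem_filter, mem_univ, true_and, mem_singleton]
        constructor
        · rintro ⟨-, rfl⟩; rfl
        · rintro rfl; refine ⟨fun h => hx (τ.injective h), rfl⟩
      rw [h1, h2, card_singleton, card_singleton]
    · push Not at hx
      have h1 : (S.filter fun j => j = x) = ∅ := by
        ext j; simp only [hS, mem_filter, mem_univ, true_and, Finset.notMem_empty, iff_false, not_and]
        rintro hj rfl; exact hj hx
      have h2 : (S.filter fun j => j = τ x) = ∅ := by
        ext j; simp only [hS, mem_filter, mem_univ, true_and, Finset.notMem_empty, iff_false, not_and]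
        rintro hj rfl; exact hj (by rw [hx, hx])
      rw [h1, h2]
  have e1 := Finset.card_sdiff_add_card_inter A B
  have e2 := Finset.card_sdiff_add_card_inter B A
  rw [Finset.inter_comm B A] at e2
  omega

/-- the covering number is constant. -/
theorem cover_eq (U : Fin m → Finset (Fin m)) (hUF : ∀ j, τ j ≠ j → (j ∈ U j ∧ P (τ⁻¹ j) ∈ U j ∧ (U j).card < m ∧ τ⁻¹ j ∉ U j ∧ (∀ x, x ∈ U j → x ≠ j → P x ∈ U j) ∧
      P j ∉ U j ∧ (∀ x, x ∉ U j → P x ∈ U j → x = τ⁻¹ j))) (x y : Fin m) :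
    ((univ.filter fun j => τ j ≠ j).filter fun j => x ∈ U j).card =
      ((univ.filter fun j => τ j ≠ j).filter fun j => y ∈ U j).card := by
  obtain ⟨i, -, h⟩ := exists_pow_lt P hfix hcyc x y
  rw [← h]
  clear h
  induction i with
  | zero => simp
  | succ i ih => rw [pow_succ', Equiv.Perm.mul_apply, cover_apply P τ U hUF, ih]

/-- **THE ONE-JUMP ARC EXISTS.**  For `b` moved by `τ` and any `c`, some `j` moved by `τ` has an arc containing `c` and not containing `b` except
as its end `j = b` (pigeonhole: the arcs containing `c` are as many as those containing `b`, one of which ends at `b`). [this cell] -/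
theorem exists_arc (U : Fin m → Finset (Fin m)) (hUF : ∀ j, τ j ≠ j → (j ∈ U j ∧ P (τ⁻¹ j) ∈ U j ∧ (U j).card < m ∧ τ⁻¹ j ∉ U j ∧ (∀ x, x ∈ U j → x ≠ j → P x ∈ U j) ∧
      P j ∉ U j ∧ (∀ x, x ∉ U j → P x ∈ U j → x = τ⁻¹ j))) (b c : Fin m) (hb : τ b ≠ b) :
    ∃ j, τ j ≠ j ∧ c ∈ U j ∧ (b ∉ U j ∨ b = j) := by
  classical
  by_contra hnone
  push Not at hnone
  set S := (univ.filter fun j => τ j ≠ j) with hS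
  set Sc := S.filter fun j => c ∈ U j with hSc
  set Sb := S.filter fun j => b ∈ U j with hSb
  have hsub : Sc ⊆ Sb.erase b := by
    intro j hj
    obtain ⟨hjS, hjc⟩ := mem_filter.mp hj
    have hjτ : τ j ≠ j := (mem_filter.mp hjS).2
    obtain ⟨hbj, hne⟩ := hnone j hjτ hjc
    exact mem_erase.mpr ⟨fun h => hne h.symm, mem_filter.mpr ⟨hjS, hbj⟩⟩
  have hbSb : b ∈ Sb := mem_filter.mpr ⟨mem_filter.mpr ⟨mem_univ _, hb⟩, (hUF b hb).1⟩
  have h1 : Sc.card ≤ Sb.card - 1 := by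
    have := card_le_card hsub; rwa [card_erase_of_mem hbSb] at this
  have h2 : Sc.card = Sb.card := cover_eq P τ hfix hcyc U hUF c b
  have h3 : 0 < Sb.card := card_pos.mpr ⟨b, hbSb⟩
  omega

end Arc

/-! ## 3. CORE LAW C -/

section Law

variable {K : ℕ}

/-- **CORE LAW C (TOP-HEAVY CORE).**  For every format `(m, K)`, `m ≥ 2`, and classes `c₀, …, c₄` with `d c₀ < d c₁ < d c₂ < d c₃`, `d c₀` minimal,
NO design has three dominant terms `P_A = (σA, λA)` (class `c₂` at two columns `a₁ ≠ a₂`, `c₁` elsewhere), `P_B = (σB, λB)` (`c₃` at one column `b`,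
`c₁` elsewhere), `P_C = (σC, λC)` (`c₄` at one column `c`, `c₀` elsewhere) with `P_C` the latest (`θA, θB < θC`; i.e. slope of `P_C` the largest).
Consequently such formats are not counting-tight whenever `d c₄ + (m−1) d c₀ > max((m−2) d c₁ + 2 d c₂, (m−1) d c₁ + d c₃)`. [this cell] -/
theorem core_law_C (d : Fin K → ℕ) (v ε : Fin m → Fin m → Fin K → ℤ) (hm : 2 ≤ m)
    {c₀ c₁ c₂ c₃ c₄ : Fin K} (h01 : d c₀ < d c₁) (h12 : d c₁ < d c₂) (h23 : d c₂ < d c₃) (hmin : ∀ l, d c₀ ≤ d l)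
    {σA σB σC : Equiv.Perm (Fin m)} {lA lB lC : Fin m → Fin K} {a₁ a₂ b c : Fin m} (hne : a₁ ≠ a₂)
    (hlA : ∀ x, lA x = if x = a₁ ∨ x = a₂ then c₂ else c₁) (hlB : ∀ x, lB x = if x = b then c₃ else c₁)
    (hlC : ∀ x, lC x = if x = c then c₄ else c₀)
    {θA θB θC : ℤ} (hA : IsDominant d v ε θA (σA, lA)) (hB : IsDominant d v ε θB (σB, lB)) (hC : IsDominant d v ε θC (σC, lC))
    (hAC : θA < θC) (hBC : θB < θC) : False := by
  classical
  -- `P_A ≠ P_B` (their classes differ at `b`), so `θA ≠ θB`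
  have hABne : ((σA, lA) : Equiv.Perm (Fin m) × (Fin m → Fin K)) ≠ (σB, lB) := by
    intro h
    have hl : lA b = lB b := by rw [(Prod.mk.inj h).2]
    rw [hlA b, hlB b, if_pos rfl] at hl
    have hc13 : c₁ ≠ c₃ := fun e => by rw [e] at h12; exact lt_asymm h12 h23
    have hc23 : c₂ ≠ c₃ := fun e => by rw [e] at h23; exact lt_irrefl _ h23
    split_ifs at hl
    · exact hc23 hl
    · exact hc13 hl
  have hAB : θA ≠ θB := by
    rintro rfl
    exact lt_asymm (hA.2 _ (Ne.symm hABne) hB.1) (hB.2 _ hABne hA.1)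
  -- the quotient against `C`
  have hlB_ge : ∀ x, d c₁ ≤ d (lB x) := fun x => by rw [hlB x]; split_ifs <;> omega
  obtain ⟨hfixBC, hcycBC⟩ := hamiltonian_AC d v ε hBC hB hC c (c₀ := c₀) (fun x hx => by rw [hlC x, if_neg hx])
    (fun x => lt_of_lt_of_le h01 (hlB_ge x)) hm
  set P : Equiv.Perm (Fin m) := σC⁻¹ * σB with hPdef
  have hPinv : P = (σB⁻¹ * σC)⁻¹ := by rw [hPdef, mul_inv_rev, inv_inv]
  have hfix : ∀ x, P x ≠ x := by
    intro x h
    apply hfixBC x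
    rw [Equiv.Perm.mul_apply, Equiv.Perm.inv_eq_iff_eq]
    rw [hPdef, Equiv.Perm.mul_apply, Equiv.Perm.inv_eq_iff_eq] at h
    exact h.symm
  have hcyc : ∀ x y, P.SameCycle x y := by
    intro x y
    rw [hPinv, Equiv.Perm.sameCycle_inv]
    exact (hcycBC x).symm.trans (hcycBC y)
  set τ : Equiv.Perm (Fin m) := σA⁻¹ * σB with hτdef
  -- `b` is moved by `τ`
  obtain ⟨h12c, h1b⟩ := sameCycle_specials d v ε hAB hA hB hne hlA hlB h12 h23
  have hb : τ b ≠ b := by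
    intro hfb
    have e1 : a₁ = b := h1b.eq_of_right hfb
    have hfa : τ a₁ = a₁ := by rw [e1]; exact hfb
    exact hne (h12c.eq_of_left hfa)
  -- the one-jump arc
  obtain ⟨Uf, hUF⟩ := exists_arcFamily P τ hfix hcyc
  obtain ⟨j, hj, hcU, hbU⟩ := exists_arc P τ hfix hcyc Uf hUF b c hb
  obtain ⟨hjU, hfirst, hcard, hstart, hstep, -, -⟩ := hUF j hj
  set U := Uf j with hUdef
  have hUne : U ≠ univ := by
    intro h
    have := hcard
    rw [h, card_univ, Fintype.card_fin] at this
    exact lt_irrefl _ this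
  -- the transversal's row map, through `σC`
  have hτinv : ∀ x, τ⁻¹ x = σB⁻¹ (σA x) := fun x => by rw [hτdef, mul_inv_rev, inv_inv, Equiv.Perm.mul_apply]
  have hPB : ∀ x, σC (P x) = σB x := fun x => by rw [hPdef, Equiv.Perm.mul_apply]; simp
  have hQA : σC (P (τ⁻¹ j)) = σA j := by rw [hPB, hτinv]; simp
  let g : Fin m → Fin m := fun x => if x ∈ U then (if x = j then P (τ⁻¹ j) else P x) else x
  have hfg : ∀ x, (if x ∈ U then (if x = j then σA x else σB x) else σC x) = σC (g x) := by
    intro x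
    by_cases hx : x ∈ U
    · by_cases hxj : x = j
      · simp only [g, if_pos hx, if_pos hxj]; rw [hxj, hQA]
      · simp only [g, if_pos hx, if_neg hxj]; rw [hPB]
    · simp only [g, if_neg hx]
  have hgU : ∀ x, x ∈ U → g x ∈ U := by
    intro x hx
    by_cases hxj : x = j
    · simp only [g, if_pos hx, if_pos hxj]; exact hfirst
    · simp only [g, if_pos hx, if_neg hxj]; exact hstep x hx hxj
  have hgU' : ∀ x, x ∉ U → g x = x := fun x hx => by simp only [g, if_neg hx]
  have hginj : Function.Injective g := by
    intro x y hxy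
    by_cases hx : x ∈ U
    · by_cases hy : y ∈ U
      · -- both on the arc
        by_cases hxj : x = j
        · by_cases hyj : y = j
          · rw [hxj, hyj]
          · exfalso
            have e : P (τ⁻¹ j) = P y := by simpa only [g, if_pos hx, if_pos hxj, if_pos hy, if_neg hyj] using hxy
            have : τ⁻¹ j = y := P.injective e
            exact hstart (this ▸ hy)
        · by_cases hyj : y = j
          · exfalso
            have e : P x = P (τ⁻¹ j) := by simpa only [g, if_pos hx, if_neg hxj, if_pos hy, if_pos hyj] using hxy
            have : x = τ⁻¹ j := P.injective e
            exact hstart (this ▸ hx)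
          · have e : P x = P y := by simpa only [g, if_pos hx, if_neg hxj, if_pos hy, if_neg hyj] using hxy
            exact P.injective e
      · exfalso; apply hy; rw [← hgU' y hy, ← hxy]; exact hgU x hx
    · by_cases hy : y ∈ U
      · exfalso; apply hx; rw [← hgU' x hx, hxy]; exact hgU y hy
      · rw [← hgU' x hx, ← hgU' y hy, hxy]
  have hinj : Function.Injective fun x => if x ∈ U then (if x = j then σA x else σB x) else σC x := by
    intro x y hxy
    have : σC (g x) = σC (g y) := by rw [← hfg x, ← hfg y]; exact hxy
    exact hginj (σC.injective this)
  exact core_of_arc d v ε hm h01 h12 h23 hlA hlB hlC hmin hA hB hC hAC hBC hAB U j hjU hcU hbU hUne hinj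

end Law

end Summit.ValiantsHypothesis.ValiantsHypothesis.Theorems.KPlusLogSqLaw.TopHeavyCore
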